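import Summits.AtomisticToContinuum.HydrodynamicLimit.Theses.LambertianContactSwap
import HarnessLib

/-!
# Stub `stub_abstractDV` of the line `Sketch` of the crux `ContactAngleEquidistribution`
# (stmt-AtomisticToContinuum-12097, route LambertianContactSwap)

Registered stub of the lead skeleton `Cruxes/ContactAngleEquidistribution/Lines/Sketch.lean` (v3, Donsker–Varadhan
transfer).  The signature below is VERBATIM the registered one.

Mathematics (pure measure theory, the bookkeeping of a large-deviation transfer by change of measure).
Fix `ε > 0`. From `E_μ W ≤ K` (WLOG `K ≥ 0`) choose `V := max 1 (8K/ε)`, so that `|∫ R dμ| ≤ (2/V) K ≤ ε/4`;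
`|∫ B dμ| < ε/4` eventually by the near-field hypothesis; `A, B, R` are `μ`-integrable (`|·| ≤ c W`), so
`∫ D = ∫ A + ∫ B + ∫ R`. THE ISOLATED PART `A` (elementary Donsker–Varadhan / Fenchel–Young route, no
relative entropy needed): for a probability measure `μ ≤ e^L ν` and a `μ`-integrable `Y` with
`I := ∫ e^Y dν < ∞`, the pointwise inequality `Y ≤ e^{Y-t} + t - 1` with `t := L + log I` integrates to
`∫ Y dμ ≤ e^{-t} ∫ e^Y dμ + t - 1 ≤ e^{-t} e^L I + t - 1 = L + log I`
(`integral_le_add_log_integral_exp_of_le_smul`, the entropy inequality with `KL(μ‖ν) ≤ L`). Applied to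
`Y = ± l c_N A`, `c_N = (N+1)^{4/3}`, `0 < l ≤ l₀`, `L = C(N+1)`, `log I ≤ c_N (C_A l² + δ_N l)` (the MGF
hypothesis) it gives `|∫ A dμ_N| ≤ C(N+1)/(l c_N) + C_A l + δ_N` (`abs_integral_le_of_lintegral_exp_le`).
Choosing the FIXED tilt `l := min l₀ (ε / (12 (|C_A| + 1)))` makes `C_A l ≤ ε/12`, while
`(N+1)/c_N = (N+1)^{-1/3} → 0` and `δ_N → 0` make the two other terms `< ε/12` eventually; so
`|∫ A dμ_N| < ε/4` eventually and `|∫ D dμ_N| < ε`.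
-/

noncomputable section

open MeasureTheory Filter Set Topology ProbabilityTheory
open scoped ENNReal BigOperators Classical

namespace Summit.AtomisticToContinuum.HydrodynamicLimit.Theorems.ContactAngleEquidistributionSketch

variable {Ω : Type*} [MeasurableSpace Ω]

/-! ### The elementary Donsker–Varadhan transfer -/

/-- **Entropy inequality under domination (elementary Donsker–Varadhan / Fenchel–Young).** For a
probability measure `μ ≤ e^L ν` (`ν ≠ 0`) and a `μ`-integrable `Y` with `e^Y` `ν`-integrable:
`∫ Y dμ ≤ L + log ∫ e^Y dν`. Proof: with `I := ∫ e^Y dν > 0` and `t := L + log I`, integrate the pointwise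
`Y ≤ e^{-t} e^Y + t - 1` against `μ` and use `∫ e^Y dμ ≤ e^L I`, so that the right-hand side is
`e^{-t} e^L I + t - 1 = t`. (This is `∫ Y dμ ≤ KL(μ‖ν) + log ∫ e^Y dν` combined with
`KL(μ‖ν) ≤ log ‖dμ/dν‖_∞ ≤ L`, proved without Radon–Nikodym derivatives.) [folklore] -/
theorem integral_le_add_log_integral_exp_of_le_smul {μ ν : Measure Ω} [IsProbabilityMeasure μ] [NeZero ν]
    {L : ℝ} (hdom : μ ≤ ENNReal.ofReal (Real.exp L) • ν) {Y : Ω → ℝ} (hYi : Integrable Y μ)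
    (hexp : Integrable (fun z => Real.exp (Y z)) ν) :
    ∫ z, Y z ∂μ ≤ L + Real.log (∫ z, Real.exp (Y z) ∂ν) := by
  set I : ℝ := ∫ z, Real.exp (Y z) ∂ν
  have hI : 0 < I := integral_exp_pos hexp
  -- `e^Y` is `e^L ν`- and `μ`-integrable, with `∫ e^Y dμ ≤ e^L I`
  have hexpΛν : Integrable (fun z => Real.exp (Y z)) (ENNReal.ofReal (Real.exp L) • ν) :=
    hexp.smul_measure ENNReal.ofReal_ne_top
  have hexpμ : Integrable (fun z => Real.exp (Y z)) μ := hexpΛν.mono_measure hdom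
  have hμν : ∫ z, Real.exp (Y z) ∂μ ≤ Real.exp L * I :=
    calc ∫ z, Real.exp (Y z) ∂μ ≤ ∫ z, Real.exp (Y z) ∂(ENNReal.ofReal (Real.exp L) • ν) :=
          integral_mono_measure hdom (ae_of_all _ fun z => (Real.exp_pos _).le) hexpΛν
      _ = Real.exp L * I := by
          rw [integral_smul_measure, ENNReal.toReal_ofReal (Real.exp_pos L).le, smul_eq_mul]
  -- the pointwise Fenchel–Young inequality with `t = L + log I`, integrated against `μ`
  set t : ℝ := L + Real.log I with ht
  have hpt : ∀ z, Y z ≤ Real.exp (-t) * Real.exp (Y z) + (t - 1) := fun z => by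
    have h1 := Real.add_one_le_exp (Y z - t)
    have h2 : Real.exp (Y z - t) = Real.exp (-t) * Real.exp (Y z) := by
      rw [← Real.exp_add]
      ring_nf
    linarith
  have hint : Integrable (fun z => Real.exp (-t) * Real.exp (Y z) + (t - 1)) μ :=
    (hexpμ.const_mul _).add (integrable_const _)
  have hone : Real.exp (-t) * (Real.exp L * I) = 1 := by
    rw [ht, Real.exp_neg, Real.exp_add, Real.exp_log hI]
    exact inv_mul_cancel₀ (mul_pos (Real.exp_pos L) hI).ne'
  calc ∫ z, Y z ∂μ ≤ ∫ z, (Real.exp (-t) * Real.exp (Y z) + (t - 1)) ∂μ := integral_mono hYi hint hpt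
    _ = Real.exp (-t) * ∫ z, Real.exp (Y z) ∂μ + (t - 1) := by
        rw [integral_add (hexpμ.const_mul _) (integrable_const _), integral_const_mul, integral_const,
          probReal_univ, one_smul]
    _ ≤ Real.exp (-t) * (Real.exp L * I) + (t - 1) := by
        gcongr
    _ = L + Real.log I := by rw [hone, ht]; ring

/-- **Change of measure by an exponential-moment bound.** For a probability measure `μ ≤ e^L ν`
(`ν ≠ 0`), a `μ`-integrable measurable `Y` and `∫⁻ e^Y dν ≤ e^B` (the `lintegral` format of the MGF
hypothesis): `∫ Y dμ ≤ L + B`. [folklore] -/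
theorem integral_le_add_of_le_smul_of_lintegral_exp_le {μ ν : Measure Ω} [IsProbabilityMeasure μ] [NeZero ν]
    {L B : ℝ} (hdom : μ ≤ ENNReal.ofReal (Real.exp L) • ν) {Y : Ω → ℝ} (hYm : Measurable Y)
    (hYi : Integrable Y μ) (hB : ∫⁻ z, ENNReal.ofReal (Real.exp (Y z)) ∂ν ≤ ENNReal.ofReal (Real.exp B)) :
    ∫ z, Y z ∂μ ≤ L + B := by
  -- `e^Y` is `ν`-integrable with `∫ e^Y dν ≤ e^B`, hence `log ∫ e^Y dν ≤ B`
  have hexp : Integrable (fun z => Real.exp (Y z)) ν := by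
    refine ⟨hYm.exp.aestronglyMeasurable, ?_⟩
    rw [hasFiniteIntegral_iff_ofReal (ae_of_all _ fun z => (Real.exp_pos _).le)]
    exact hB.trans_lt ENNReal.ofReal_lt_top
  have hle : ∫ z, Real.exp (Y z) ∂ν ≤ Real.exp B := by
    rw [← ENNReal.ofReal_le_ofReal_iff (Real.exp_pos B).le,
      ofReal_integral_eq_lintegral_ofReal hexp (ae_of_all _ fun z => (Real.exp_pos _).le)]
    exact hB
  have hlog : Real.log (∫ z, Real.exp (Y z) ∂ν) ≤ B := by
    rw [← Real.log_exp B]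
    exact Real.log_le_log (integral_exp_pos hexp) hle
  exact (integral_le_add_log_integral_exp_of_le_smul hdom hYi hexp).trans (by linarith)

/-- **The isolated-collision bound for one `N`.** For a probability measure `μ ≤ e^L ν` (`ν ≠ 0`), a
`μ`-integrable measurable `a`, a tilt `l > 0`, a scale `c > 0` and the two-sided exponential-moment
bounds `∫⁻ e^{± l c a} dν ≤ e^{c (C_A l² + d l)}`: `|∫ a dμ| ≤ L/(l c) + C_A l + d`. [folklore] -/
theorem abs_integral_le_of_lintegral_exp_le {μ ν : Measure Ω} [IsProbabilityMeasure μ] [NeZero ν] {L : ℝ}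
    (hdom : μ ≤ ENNReal.ofReal (Real.exp L) • ν) {a : Ω → ℝ} (ham : Measurable a) (hai : Integrable a μ)
    {l c CA d : ℝ} (hl : 0 < l) (hc : 0 < c)
    (hplus : ∫⁻ z, ENNReal.ofReal (Real.exp (l * c * a z)) ∂ν ≤
      ENNReal.ofReal (Real.exp (c * (CA * l ^ 2 + d * |l|))))
    (hminus : ∫⁻ z, ENNReal.ofReal (Real.exp (-l * c * a z)) ∂ν ≤
      ENNReal.ofReal (Real.exp (c * (CA * (-l) ^ 2 + d * |(-l)|)))) :
    |∫ z, a z ∂μ| ≤ L / (l * c) + CA * l + d := by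
  have hlc : 0 < l * c := mul_pos hl hc
  rw [abs_of_pos hl] at hplus
  rw [abs_neg, abs_of_pos hl, neg_sq] at hminus
  have hp := integral_le_add_of_le_smul_of_lintegral_exp_le hdom (ham.const_mul (l * c)) (hai.const_mul (l * c))
    hplus
  have hm := integral_le_add_of_le_smul_of_lintegral_exp_le hdom (ham.const_mul (-l * c))
    (hai.const_mul (-l * c)) hminus
  rw [integral_const_mul] at hp hm
  have hT : L / (l * c) + CA * l + d = (L + c * (CA * l ^ 2 + d * l)) / (l * c) := by
    field_simp
    ring
  rw [hT, abs_le, neg_le, le_div_iff₀ hlc, le_div_iff₀ hlc]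
  exact ⟨by linarith, by linarith⟩

/-- `(N+1) / (N+1)^{4/3} = (N+1)^{-1/3} → 0`. [folklore] -/
theorem tendsto_natCast_add_one_div_rpow :
    Tendsto (fun N : ℕ => ((N : ℝ) + 1) / ((N : ℝ) + 1) ^ (4 / 3 : ℝ)) atTop (𝓝 0) := by
  have h : ∀ N : ℕ, ((N : ℝ) + 1) / ((N : ℝ) + 1) ^ (4 / 3 : ℝ) = ((N : ℝ) + 1) ^ (-(1 / 3 : ℝ)) := by
    intro N
    have hn : (0 : ℝ) < (N : ℝ) + 1 := by positivity
    rw [show (-(1 / 3 : ℝ)) = 1 - 4 / 3 by norm_num, Real.rpow_sub hn, Real.rpow_one]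
  simp_rw [h]
  exact (tendsto_rpow_neg_atTop (by norm_num : (0 : ℝ) < 1 / 3)).comp
    (tendsto_atTop_add_const_right atTop (1 : ℝ) tendsto_natCast_atTop_atTop)

/-! ### The registered stub -/

/-- STUB `abstractDV` of line `Sketch` (crux ContactAngleEquidistribution, stmt-AtomisticToContinuum-12097): the
Donsker–Varadhan / Jensen bookkeeping of the transfer — probability measures `μ_N ≤ e^{C(N+1)} ν_N`, a decomposition
`D = A + B + R` with `|A|,|B| ≤ 2W`, `|R| ≤ 2W/V`, `E_μ W ≤ K`, the CLT-scale MGF bound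
`∫ e^{l(N+1)^{4/3}A} dν ≤ e^{(N+1)^{4/3}(C l² + δ_N|l|)}` (`δ_N → 0`, `|l| ≤ l₀`) and `E_μ B → 0`; then `E_μ D → 0`.
[folklore] -/
theorem stub_abstractDV {α : ℕ → Type*} [∀ N, MeasurableSpace (α N)]
    (μ ν : (N : ℕ) → Measure (α N)) (hμ : ∀ N, IsProbabilityMeasure (μ N))
    (hν : ∀ N, IsProbabilityMeasure (ν N))
    (D W : (N : ℕ) → α N → ℝ) (A B R : ℝ → (N : ℕ) → α N → ℝ)
    (hD : ∀ V, 0 < V → ∀ N z, D N z = A V N z + B V N z + R V N z)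
    (hAm : ∀ V, 0 < V → ∀ N, Measurable (A V N)) (hBm : ∀ V, 0 < V → ∀ N, Measurable (B V N))
    (hRm : ∀ V, 0 < V → ∀ N, Measurable (R V N)) (hWm : ∀ N, Measurable (W N)) (hW0 : ∀ N z, 0 ≤ W N z)
    (hW : ∃ K : ℝ, ∀ N, ∫⁻ z, ENNReal.ofReal (W N z) ∂μ N ≤ ENNReal.ofReal K)
    (hAW : ∀ V, 0 < V → ∀ N z, |A V N z| ≤ 2 * W N z)
    (hBW : ∀ V, 0 < V → ∀ N z, |B V N z| ≤ 2 * W N z)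
    (hRW : ∀ V, 0 < V → ∀ N z, |R V N z| ≤ 2 / V * W N z)
    (hdom : ∃ C : ℝ, ∀ N, μ N ≤ ENNReal.ofReal (Real.exp (C * ((N : ℝ) + 1))) • ν N)
    (hmgf : ∀ V, 0 < V → ∃ l₀ : ℝ, 0 < l₀ ∧ ∃ C : ℝ, ∃ δ : ℕ → ℝ, Tendsto δ atTop (𝓝 0) ∧
      ∀ᶠ N : ℕ in atTop, ∀ l : ℝ, |l| ≤ l₀ →
        ∫⁻ z, ENNReal.ofReal (Real.exp (l * ((N : ℝ) + 1) ^ (4 / 3 : ℝ) * A V N z)) ∂ν N ≤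
          ENNReal.ofReal (Real.exp (((N : ℝ) + 1) ^ (4 / 3 : ℝ) * (C * l ^ 2 + δ N * |l|))))
    (hnear : ∀ V, 0 < V → Tendsto (fun N => ∫ z, B V N z ∂μ N) atTop (𝓝 0)) :
    Tendsto (fun N => ∫ z, D N z ∂μ N) atTop (𝓝 0) := by
  rw [Metric.tendsto_nhds]
  intro ε hε
  -- the constants `K ≥ 0`, `C`, `V ≥ max 1 (8K/ε)`
  obtain ⟨K, hK0, hWK⟩ : ∃ K : ℝ, 0 ≤ K ∧ ∀ N, ∫⁻ z, ENNReal.ofReal (W N z) ∂μ N ≤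
      ENNReal.ofReal K := by
    obtain ⟨K, hK⟩ := hW
    exact ⟨max K 0, le_max_right _ _, fun N =>
      (hK N).trans (ENNReal.ofReal_le_ofReal (le_max_left _ _))⟩
  obtain ⟨C, hC⟩ := hdom
  obtain ⟨V, hV1, hV8⟩ : ∃ V : ℝ, 1 ≤ V ∧ 8 * K / ε ≤ V :=
    ⟨max 1 (8 * K / ε), le_max_left _ _, le_max_right _ _⟩
  have hV : 0 < V := one_pos.trans_le hV1
  have hKV : 2 / V * K ≤ ε / 4 := by
    rw [div_le_iff₀ hε] at hV8
    rw [div_mul_eq_mul_div, div_le_iff₀ hV]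
    linarith
  -- the MGF data at truncation level `V` and the fixed tilt `0 < l ≤ l₀` with `|C_A| l ≤ ε/12`
  obtain ⟨l₀, hl₀, CA, δ, hδ, hmgfV⟩ := hmgf V hV
  obtain ⟨l, hl, hll₀, hlCA⟩ : ∃ l : ℝ, 0 < l ∧ l ≤ l₀ ∧ |CA| * l ≤ ε / 12 := by
    have hpos : (0 : ℝ) < |CA| + 1 := by positivity
    refine ⟨min l₀ (ε / (12 * (|CA| + 1))), lt_min hl₀ (by positivity), min_le_left _ _, ?_⟩
    calc |CA| * min l₀ (ε / (12 * (|CA| + 1)))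
        ≤ (|CA| + 1) * (ε / (12 * (|CA| + 1))) :=
          mul_le_mul (by linarith) (min_le_right _ _) (lt_min hl₀ (by positivity)).le hpos.le
      _ = ε / 12 := by
          field_simp
  have hε4 : (0 : ℝ) < ε / 4 := by positivity
  have hε12 : (0 : ℝ) < ε / 12 := by positivity
  -- the four eventualities
  have h2 : ∀ᶠ N : ℕ in atTop, |∫ z, B V N z ∂μ N| < ε / 4 := by
    filter_upwards [Metric.tendsto_nhds.1 (hnear V hV) (ε / 4) hε4] with N hN
    rwa [Real.dist_0_eq_abs] at hN
  have h3 : ∀ᶠ N : ℕ in atTop, |C| / l * (((N : ℝ) + 1) / ((N : ℝ) + 1) ^ (4 / 3 : ℝ)) < ε / 12 := by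
    have ht := tendsto_natCast_add_one_div_rpow.const_mul (|C| / l)
    rw [mul_zero] at ht
    exact (tendsto_order.1 ht).2 _ hε12
  have h4 : ∀ᶠ N : ℕ in atTop, |δ N| < ε / 12 := by
    filter_upwards [Metric.tendsto_nhds.1 hδ (ε / 12) hε12] with N hN
    rwa [Real.dist_0_eq_abs] at hN
  filter_upwards [hmgfV, h2, h3, h4] with N h1 h2 h3 h4
  haveI := hμ N
  haveI := hν N
  -- integrability (`W ∈ L¹(μ_N)` with `∫ W dμ_N ≤ K`; `|f| ≤ c W ⇒ f ∈ L¹(μ_N)`) and the split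
  -- `∫ D = ∫ A + ∫ B + ∫ R`
  have hWi : Integrable (W N) (μ N) := by
    refine ⟨(hWm N).aestronglyMeasurable, ?_⟩
    rw [hasFiniteIntegral_iff_ofReal (Eventually.of_forall (hW0 N))]
    exact (hWK N).trans_lt ENNReal.ofReal_lt_top
  have hWle : ∫ z, W N z ∂μ N ≤ K := by
    rw [integral_eq_lintegral_of_nonneg_ae (Eventually.of_forall (hW0 N)) (hWm N).aestronglyMeasurable]
    exact ENNReal.toReal_le_of_le_ofReal hK0 (hWK N)
  have hInt : ∀ {f : α N → ℝ} {c : ℝ}, Measurable f → (∀ z, |f z| ≤ c * W N z) →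
      Integrable f (μ N) := by
    intro f c hf hfW
    exact (hWi.const_mul c).mono' hf.aestronglyMeasurable (Eventually.of_forall fun z => by
      rw [Real.norm_eq_abs]
      exact hfW z)
  have hAi : Integrable (A V N) (μ N) := hInt (hAm V hV N) (hAW V hV N)
  have hBi : Integrable (B V N) (μ N) := hInt (hBm V hV N) (hBW V hV N)
  have hRi : Integrable (R V N) (μ N) := hInt (hRm V hV N) (hRW V hV N)
  have hsplit : ∫ z, D N z ∂μ N =
      (∫ z, A V N z ∂μ N) + (∫ z, B V N z ∂μ N) + ∫ z, R V N z ∂μ N := by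
    simp_rw [hD V hV N]
    rw [integral_add (f := fun z => A V N z + B V N z) (hAi.add hBi) hRi, integral_add hAi hBi]
  -- the fast part
  have hR : |∫ z, R V N z ∂μ N| ≤ ε / 4 :=
    calc |∫ z, R V N z ∂μ N| ≤ ∫ z, |R V N z| ∂μ N := abs_integral_le_integral_abs
      _ ≤ ∫ z, 2 / V * W N z ∂μ N := integral_mono hRi.abs (hWi.const_mul _) (hRW V hV N)
      _ = 2 / V * ∫ z, W N z ∂μ N := integral_const_mul _ _
      _ ≤ 2 / V * K := mul_le_mul_of_nonneg_left hWle (by positivity)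
      _ ≤ ε / 4 := hKV
  -- the isolated part, by the Donsker–Varadhan transfer at tilt `± l`
  have hA : |∫ z, A V N z ∂μ N| < ε / 4 := by
    have hn : (0 : ℝ) < (N : ℝ) + 1 := by positivity
    have hc : (0 : ℝ) < ((N : ℝ) + 1) ^ (4 / 3 : ℝ) := Real.rpow_pos_of_pos hn _
    have hp := h1 l (by rwa [abs_of_pos hl])
    have hm := h1 (-l) (by rwa [abs_neg, abs_of_pos hl])
    have key := abs_integral_le_of_lintegral_exp_le (hC N) (hAm V hV N) hAi hl hc hp hm
    have e1 : C * ((N : ℝ) + 1) / (l * ((N : ℝ) + 1) ^ (4 / 3 : ℝ)) ≤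
        |C| / l * (((N : ℝ) + 1) / ((N : ℝ) + 1) ^ (4 / 3 : ℝ)) := by
      rw [mul_div_mul_comm]
      gcongr
      exact le_abs_self C
    have e2 : CA * l ≤ ε / 12 := (mul_le_mul_of_nonneg_right (le_abs_self CA) hl.le).trans hlCA
    have e3 : δ N ≤ |δ N| := le_abs_self _
    linarith
  -- summing up
  rw [Real.dist_0_eq_abs, hsplit]
  calc |(∫ z, A V N z ∂μ N) + (∫ z, B V N z ∂μ N) + ∫ z, R V N z ∂μ N|
      ≤ |(∫ z, A V N z ∂μ N) + ∫ z, B V N z ∂μ N| + |∫ z, R V N z ∂μ N| := abs_add_le _ _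
    _ ≤ |∫ z, A V N z ∂μ N| + |∫ z, B V N z ∂μ N| + |∫ z, R V N z ∂μ N| := by
        gcongr
        exact abs_add_le _ _
    _ < ε := by linarith

end Summit.AtomisticToContinuum.HydrodynamicLimit.Theorems.ContactAngleEquidistributionSketch

end
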